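import Mathlib
import HarnessLib

/-!
# Box-local evaluation of a link-local update is exact (transport of a local rule along a box embedding)

HONEST FRAMING: exact (Metropolis-corrected) sampling algorithms for lattice gauge theory;
figures of merit are autocorrelation/cost numbers at stated couplings and volumes; no
continuum-physics claim.

Venture `LatticeQCDFlow` (cell pub-lqcd), topic `Exactness`; FANOUT row 13 (`eng-snf`, the
`latflow-snf` protocol engine).  NEW WORK of the cell (elementary rewriting and modular
arithmetic), not a published result; nothing is cited as a fact.

## Content

`latflow-snf` 0.1.8 evaluates a LINK-LOCAL coupling layer — the stout-DEFECT residual layers of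
the defect protocols: the new value of an active link and its Jacobian factor read only the six
staples of that link — not on the whole lattice but on the periodic SUB-BOX spanned by the active
links widened by the stencil ("halo"): it copies the box out of the configuration, applies a layer
object BUILT ON THE BOX'S OWN PERIODIC GEOMETRY, sums the per-link log-Jacobians there, and writes
the active links back (`adapters.LinkBox`, `PerConfigLayerAdapter(box=…)`).  The numbers are
bit-identical to the full-lattice evaluation at a cost O(box) instead of O(volume).  THIS file is
the reason, with the hypotheses the engine asserts at run time made explicit:

* links `ι` (lattice) and `κ` (box) carrying values in `G`, the box's global coordinates
  `e : κ → ι`; a stencil index `D` with neighbour maps `nL : ι → D → ι` (lattice adjacency) and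
  `nB : κ → D → κ` (the box's OWN periodic adjacency); a site-dependent local rule
  `R : ι → (D → G) → G` (the new value of link `i` from the values on its stencil — site-dependent
  because the smearing parameter is a profile), used on the box as `R ∘ e` (gathered profile);
  active predicates `actL`, `actB` with `actB k ↔ actL (e k)`;
* (ADJ) on ACTIVE box links the two adjacencies agree through `e`: `e (nB k d) = nL (e k) d`.
  `applyRule_extract` — then extract-then-apply-on-the-box equals apply-on-the-lattice-then-extract
  (a commuting square), and `eq_applyRule_of_writeBack` — writing the box result's active entries
  back into the configuration IS the lattice update, provided every active lattice link lies in the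
  box (`hrange`); `sum_logJac_transport` — a per-active-link Jacobian factor that is itself a
  local rule has the same total over the box's active links as over the lattice's (`e` injective on
  the active set, image = the lattice active set);
* WITHOUT (ADJ) the box evaluation is wrong in general (`applyRule_extract_fails_without_adj`: a
  3-periodic box cut out of a 4-periodic ring wraps an active link's neighbour to the wrong link);
* (ADJ) for the engine's concrete boxes, per lattice axis (sites are tuples, adjacency acts per
  axis, so the per-axis statement is the whole content): the box coordinate `k < b` maps to the
  lattice coordinate `(o + k) mod L` and a stencil offset `t` acts as `(k + t) mod b` on the box and
  `(· + t) mod L` on the lattice; `boxAxis_adj_interior` — they agree through the embedding whenever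
  `0 ≤ k + t < b` (the active coordinate is at least `|t|` away from both box faces: the engine's
  "stencil interior" assertion, halo ≥ |t|), and `boxAxis_adj_fullAxis` — or for every `k` when the
  box takes the whole axis (`b = L`, `o = 0`), the engine's fallback when the widened run would
  reach `L`.  A box face that is neither far from the active links nor a true lattice face is
  exactly the excluded case.

Dictionary: `ι` = links `(μ, x)` of the `L₀×…×L₃` lattice, `G = SU(N)`; `R i` = the stout/residual
update `U ↦ exp(Q_i(U, staples)) U` with `ρ(i)`; `D` = the six staple slots (links at
`x, x±ν, x+μ, x+μ−ν`), halo 1; the log-Jacobian rule `J i` = `log |det(1 + Φ_Q ∘ DQ)|` of the same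
staples.  The action difference of the update is the other half of the bookkeeping and is row 9's
`LocalActionDifference.lean` (masked plaquette sums are exact).
-/

namespace Summit.Ventures.LatticeQCDFlow.Exactness

open Finset

variable {ι κ D G : Type*}

section LocalRuleTransport

/-- Apply a site-dependent local rule at the active links, reading each stencil through the
neighbour map `n`; inactive links keep their value.  (`latflow.equiv` `ResidualCoupling.forward`
restricted to its site mask, abstractly.) -/
def applyRule (n : ι → D → ι) (R : ι → (D → G) → G) (act : ι → Prop) [DecidablePred act]
    (x : ι → G) : ι → G :=
  fun i => if act i then R i (fun d => x (n i d)) else x i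

/-- At an active link the rule is applied to the stencil values. -/
theorem applyRule_of_act {n : ι → D → ι} {R : ι → (D → G) → G} {act : ι → Prop}
    [DecidablePred act] {x : ι → G} {i : ι} (hi : act i) :
    applyRule n R act x i = R i (fun d => x (n i d)) := by
  simp [applyRule, hi]

/-- An inactive link keeps its value. -/
theorem applyRule_of_not_act {n : ι → D → ι} {R : ι → (D → G) → G} {act : ι → Prop}
    [DecidablePred act] {x : ι → G} {i : ι} (hi : ¬ act i) :
    applyRule n R act x i = x i := by
  simp [applyRule, hi]

/-- THE COMMUTING SQUARE.  If the box adjacency agrees with the lattice adjacency through the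
embedding on every ACTIVE box link (ADJ), then applying the transported rule `R ∘ e` on the box to
the extracted configuration `x ∘ e` gives exactly the extraction of the lattice update. -/
theorem applyRule_extract (e : κ → ι) (nL : ι → D → ι) (nB : κ → D → κ) (R : ι → (D → G) → G)
    (actL : ι → Prop) (actB : κ → Prop) [DecidablePred actL] [DecidablePred actB]
    (hact : ∀ k, actB k ↔ actL (e k)) (hadj : ∀ k, actB k → ∀ d, e (nB k d) = nL (e k) d)
    (x : ι → G) :
    applyRule nB (fun k => R (e k)) actB (x ∘ e) = applyRule nL R actL x ∘ e := by
  funext k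
  by_cases hk : actB k
  · have hk' : actL (e k) := (hact k).1 hk
    simp only [Function.comp_apply, applyRule_of_act hk, applyRule_of_act hk']
    congr 1
    funext d
    simp [hadj k hk d]
  · have hk' : ¬ actL (e k) := fun h => hk ((hact k).2 h)
    simp only [Function.comp_apply, applyRule_of_not_act hk, applyRule_of_not_act hk']

/-- WRITE-BACK IS THE LATTICE UPDATE.  Let `w` be the box result and `y` the configuration obtained
from `x` by writing the ACTIVE entries of `w` back along `e` and leaving every other link as in `x`
(the two clauses `hy_act`, `hy_off`).  If moreover every active lattice link lies in the box
(`hrange`), then `y` is the full-lattice update of `x`. -/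
theorem eq_applyRule_of_writeBack (e : κ → ι) (nL : ι → D → ι) (nB : κ → D → κ)
    (R : ι → (D → G) → G) (actL : ι → Prop) (actB : κ → Prop) [DecidablePred actL]
    [DecidablePred actB] (hact : ∀ k, actB k ↔ actL (e k))
    (hadj : ∀ k, actB k → ∀ d, e (nB k d) = nL (e k) d)
    (hrange : ∀ i, actL i → ∃ k, e k = i) (x y : ι → G) (w : κ → G)
    (hw : w = applyRule nB (fun k => R (e k)) actB (x ∘ e))
    (hy_act : ∀ k, actB k → y (e k) = w k)
    (hy_off : ∀ i, (¬ ∃ k, actB k ∧ e k = i) → y i = x i) :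
    y = applyRule nL R actL x := by
  funext i
  by_cases h : ∃ k, actB k ∧ e k = i
  · obtain ⟨k, hk, rfl⟩ := h
    rw [hy_act k hk, hw, applyRule_extract e nL nB R actL actB hact hadj x]
    rfl
  · rw [hy_off i h]
    have hi : ¬ actL i := by
      intro hi
      obtain ⟨k, rfl⟩ := hrange i hi
      exact h ⟨k, (hact k).2 hi, rfl⟩
    rw [applyRule_of_not_act hi]

/-- LOG-JACOBIAN TOTALS AGREE.  A per-active-link Jacobian factor that is itself a local rule
`J i (stencil values)` sums to the same total over the box's active links (read through the box
adjacency) as over the lattice's active links, when `e` maps the former injectively onto the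
latter and (ADJ) holds. -/
theorem sum_logJac_transport [DecidableEq ι] (e : κ → ι) (nL : ι → D → ι) (nB : κ → D → κ)
    (J : ι → (D → G) → ℝ) (AL : Finset ι) (AB : Finset κ) (himg : AB.image e = AL)
    (hinj : Set.InjOn e AB) (hadj : ∀ k ∈ AB, ∀ d, e (nB k d) = nL (e k) d) (x : ι → G) :
    ∑ k ∈ AB, J (e k) (fun d => (x ∘ e) (nB k d)) = ∑ i ∈ AL, J i (fun d => x (nL i d)) := by
  rw [← himg, Finset.sum_image (fun a ha b hb h => hinj ha hb h)]
  refine Finset.sum_congr rfl fun k hk => ?_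
  congr 1
  funext d
  simp [hadj k hk d]

/-- WITHOUT (ADJ) THE BOX EVALUATION IS WRONG IN GENERAL.  Lattice = the 4-periodic ring `Fin 4`
with the single stencil slot "right neighbour" and the rule "copy your right neighbour"; box = the
3-periodic ring `Fin 3` embedded as `0, 1, 2`; the active link `2` sits ON the box face that is not
a lattice face: the box wraps its neighbour to box link `0` = lattice link `0`, the lattice
neighbour is link `3`.  With `x = (0, 0, 0, 1)` the box says `0`, the lattice says `1`. -/
theorem applyRule_extract_fails_without_adj :
    let e : Fin 3 → Fin 4 := fun k => ⟨k.val, by omega⟩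
    let nL : Fin 4 → Unit → Fin 4 := fun i _ => i + 1
    let nB : Fin 3 → Unit → Fin 3 := fun k _ => k + 1
    let R : Fin 4 → (Unit → ℕ) → ℕ := fun _ v => v ()
    let actL : Fin 4 → Prop := fun i => i = 2
    let actB : Fin 3 → Prop := fun k => k = 2
    let x : Fin 4 → ℕ := fun i => if i = 3 then 1 else 0
    applyRule nB (fun k => R (e k)) actB (x ∘ e) ≠ applyRule nL R actL x ∘ e := by
  intro e nL nB R actL actB x h
  have h2 := congrFun h 2
  simp [applyRule, e, nL, nB, R, actL, actB, x, Fin.ext_iff] at h2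

end LocalRuleTransport

section BoxAxis

/-! ## (ADJ) for the engine's boxes, per axis

On one lattice axis of length `L` the box is the run of `b` consecutive coordinates starting at
`o` (mod `L`): box coordinate `k` (`0 ≤ k < b`) ↦ lattice coordinate `(o + k) mod L`.  A stencil
offset `t : ℤ` (`|t| ≤ halo`) moves to `(k + t) mod b` on the periodic box and to `(· + t) mod L` on
the lattice. -/

/-- The box's global coordinate along one axis. -/
def boxAxisEmb (L o k : ℤ) : ℤ := (o + k) % L

/-- INTERIOR CASE.  If the shifted box coordinate does not wrap (`0 ≤ k + t < b` — the active
coordinate is at least `|t|` away from both faces, the engine's "stencil interior" assertion with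
halo ≥ |t|), the box shift and the lattice shift agree through the embedding. -/
theorem boxAxis_adj_interior (L o b k t : ℤ) (hk0 : 0 ≤ k + t) (hkb : k + t < b) :
    boxAxisEmb L o ((k + t) % b) = (boxAxisEmb L o k + t) % L := by
  unfold boxAxisEmb
  rw [Int.emod_eq_of_lt hk0 hkb, Int.emod_add_emod, add_assoc]

/-- WHOLE-AXIS CASE.  If the box takes the whole axis (`b = L`, offset `o = 0`; the engine's
fallback whenever the widened run would reach `L`), the two shifts agree for EVERY coordinate: the
box's periodicity is the lattice's. -/
theorem boxAxis_adj_fullAxis (L k t : ℤ) :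
    boxAxisEmb L 0 ((k + t) % L) = (boxAxisEmb L 0 k + t) % L := by
  unfold boxAxisEmb
  simp [Int.emod_emod_of_dvd, Int.emod_add_emod]

/-- The excluded case is real: a box of length `b = 3` at offset `0` inside an axis of length
`L = 4`, active coordinate `k = 2` on the far face, offset `t = 1`: the box wraps to lattice
coordinate `0`, the lattice neighbour is `3`. -/
theorem boxAxis_adj_fails_on_face : boxAxisEmb 4 0 ((2 + 1) % 3) ≠ (boxAxisEmb 4 0 2 + 1) % 4 := by
  decide

end BoxAxis

end Summit.Ventures.LatticeQCDFlow.Exactness
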